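import Mathlib
import Summits.AnomalousDissipation.AnomalousDissipation.Theorems.MarginalStabilityChainStretchedVortexRowsStubRowVorticityConstructionToolsSmooth
import Summits.AnomalousDissipation.AnomalousDissipation.Theorems.MarginalStabilityChainStretchedVortexRowsStubRowVorticityConstructionToolsStrip

/-!
# Stub `stub_rowVorticityConstruction` (crux stmt-AnomalousDissipation-3009) — tools VI:
# the velocity is the skew gradient of the stream function; the cylinder Biot–Savart field is divergence free

Helper file (supports stmt-AnomalousDissipation-3009). With `S_L = (−L/2, L/2] × ℝ`, the kernel-first stream
integral `Ψ(x, y) = ∫_{S_L} Φ_L(q) ω(x − q₁, y − q₂) dq` (`Φ_L(q) = log(cosh(2πq₂/L) − cos(2πq₁/L))`) and the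
velocity integrals `U = ∫_{S_L} K₁ ω(· − q)`, `V = ∫_{S_L} K₂ ω(· − q)` (`K₁ = sinh/(cosh − cos)`,
`K₂ = sin/(cosh − cos)`), we prove for `ω ∈ C¹` (resp. `C²`), `L`-periodic in `x`, with Gaussian bounds:

* slice calculus of `C¹`/`C²` curried fields (`hasDerivAt_slice_fst/snd`, `abs_dX_le`, `abs_dY_le`,
  `continuous_dX/dY`, Schwarz `dX_dY_comm`); positivity of the denominator off the lattice lines and
  `∂_{q₂}Φ_L = (2π/L)K₁`, `∂_{q₁}Φ_L = (2π/L)K₂` there;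
* `integral_rowLogKer_mul_dY` — ONE integration by parts in `q₂` on the line for `q₁ ≠ 0` (where `Φ_L(q₁, ·)` is
  smooth; no boundary terms: `Φ_L` grows linearly, `ω` is Gaussian):
  `∫ Φ_L(q₁,t) (∂_yω)(x − q₁, y − t) dt = (2π/L) ∫ K₁(q₁,t) ω(x − q₁, y − t) dt`, the line-by-line content of
  `∂_yΨ = (2π/L)U` (assembled by Fubini in tools VII together with the periodic IBP in `q₁` and `div = 0`).
The curl identity `∂ₓv − ∂_yu = (4π)⁻¹ΔΨ = ω` is the Poisson equation for the cylinder Green's function (a later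
brick; `divFree_rowBS` itself is in tools VII). Registered sub-goal proved here:
`stub_rowVorticityConstruction_streamIBPLine`. All `[folklore]`.
-/

set_option linter.dupNamespace false

noncomputable section

open Real Set Filter Topology MeasureTheory
open Literature.Analysis.FluidPDE Literature.Analysis.FluidPDE.StretchedLayer

namespace Summit.AnomalousDissipation.AnomalousDissipation.Theorems.MarginalStabilityChainStretchedVortexRows.RowBiotSavart

/-! ### Slice calculus of `C¹`/`C²` plane fields -/

section Slices

variable {ω : ℝ → ℝ → ℝ} {C' a' : ℝ}

/-- The `y`-slices of a `C¹` field have derivative `dY`. [folklore] -/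
theorem hasDerivAt_slice_snd (hω : ContDiff ℝ 1 fun p : ℝ × ℝ => ω p.1 p.2) (x b : ℝ) :
    HasDerivAt (fun s => ω x s) (dY ω x b) b := by
  have h1 : DifferentiableAt ℝ (fun s : ℝ => ((x, s) : ℝ × ℝ)) b :=
    (differentiableAt_const x).prodMk differentiableAt_id
  have hd : DifferentiableAt ℝ ((fun p : ℝ × ℝ => ω p.1 p.2) ∘ fun s : ℝ => ((x, s) : ℝ × ℝ)) b :=
    ((hω.differentiable one_ne_zero) (x, b)).comp b h1
  exact hd.hasDerivAt

/-- The `x`-slices of a `C¹` field have derivative `dX`. [folklore] -/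
theorem hasDerivAt_slice_fst (hω : ContDiff ℝ 1 fun p : ℝ × ℝ => ω p.1 p.2) (a y : ℝ) :
    HasDerivAt (fun s => ω s y) (dX ω a y) a := by
  have h1 : DifferentiableAt ℝ (fun s : ℝ => ((s, y) : ℝ × ℝ)) a :=
    differentiableAt_id.prodMk (differentiableAt_const y)
  have hd : DifferentiableAt ℝ ((fun p : ℝ × ℝ => ω p.1 p.2) ∘ fun s : ℝ => ((s, y) : ℝ × ℝ)) a :=
    ((hω.differentiable one_ne_zero) (a, y)).comp a h1
  exact hd.hasDerivAt

/-- A bound on `Dω` bounds `dY ω` (the direction `(0,1)` has norm `1`). [folklore] -/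
theorem abs_dY_le (hω : ContDiff ℝ 1 fun p : ℝ × ℝ => ω p.1 p.2)
    (hb' : ∀ p, ‖fderiv ℝ (fun p : ℝ × ℝ => ω p.1 p.2) p‖ ≤ C' * Real.exp (-a' * p.2 ^ 2)) (x y : ℝ) :
    |dY ω x y| ≤ C' * Real.exp (-a' * y ^ 2) := by
  rw [dY_eq_fderiv hω]
  refine (Real.norm_eq_abs _ ▸ ContinuousLinearMap.le_of_opNorm_le _ (hb' (x, y)) _).trans ?_
  simp [Prod.norm_def]

/-- A bound on `Dω` bounds `dX ω`. [folklore] -/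
theorem abs_dX_le (hω : ContDiff ℝ 1 fun p : ℝ × ℝ => ω p.1 p.2)
    (hb' : ∀ p, ‖fderiv ℝ (fun p : ℝ × ℝ => ω p.1 p.2) p‖ ≤ C' * Real.exp (-a' * p.2 ^ 2)) (x y : ℝ) :
    |dX ω x y| ≤ C' * Real.exp (-a' * y ^ 2) := by
  rw [dX_eq_fderiv hω]
  refine (Real.norm_eq_abs _ ▸ ContinuousLinearMap.le_of_opNorm_le _ (hb' (x, y)) _).trans ?_
  simp [Prod.norm_def]

/-- `dY ω` of a `C¹` field is continuous (jointly). [folklore] -/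
theorem continuous_dY (hω : ContDiff ℝ 1 fun p : ℝ × ℝ => ω p.1 p.2) : Continuous fun p : ℝ × ℝ => dY ω p.1 p.2 := by
  rw [dY_uncurry_eq hω]; exact (hω.continuous_fderiv one_ne_zero).clm_apply continuous_const

/-- `dX ω` of a `C¹` field is continuous (jointly). [folklore] -/
theorem continuous_dX (hω : ContDiff ℝ 1 fun p : ℝ × ℝ => ω p.1 p.2) : Continuous fun p : ℝ × ℝ => dX ω p.1 p.2 := by
  rw [dX_uncurry_eq hω]; exact (hω.continuous_fderiv one_ne_zero).clm_apply continuous_const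

/-- **Schwarz for slice derivatives**: `∂ₓ∂_y f = ∂_y∂ₓ f` for a `C²` curried field. [folklore] -/
theorem dX_dY_comm (hω : ContDiff ℝ 2 fun p : ℝ × ℝ => ω p.1 p.2) (x y : ℝ) : dX (dY ω) x y = dY (dX ω) x y := by
  have h1 : ContDiff ℝ 1 fun p : ℝ × ℝ => ω p.1 p.2 := hω.of_le one_le_two
  set F : ℝ × ℝ → ℝ := fun p => ω p.1 p.2
  have hF1 : ContDiff ℝ 1 (fderiv ℝ F) := hω.fderiv_right le_rfl
  have hdY : (fun p : ℝ × ℝ => dY ω p.1 p.2) = fun p => fderiv ℝ F p (0, 1) := dY_uncurry_eq h1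
  have hdX : (fun p : ℝ × ℝ => dX ω p.1 p.2) = fun p => fderiv ℝ F p (1, 0) := dX_uncurry_eq h1
  have cY : ContDiff ℝ 1 fun p : ℝ × ℝ => dY ω p.1 p.2 := by rw [hdY]; exact hF1.clm_apply contDiff_const
  have cX : ContDiff ℝ 1 fun p : ℝ × ℝ => dX ω p.1 p.2 := by rw [hdX]; exact hF1.clm_apply contDiff_const
  rw [dX_eq_fderiv cY, dY_eq_fderiv cX]
  rw [show (fun p : ℝ × ℝ => dY ω p.1 p.2) = fun p => fderiv ℝ F p (0, 1) from hdY,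
    show (fun p : ℝ × ℝ => dX ω p.1 p.2) = fun p => fderiv ℝ F p (1, 0) from hdX]
  have hd : DifferentiableAt ℝ (fderiv ℝ F) (x, y) := (hF1.differentiable one_ne_zero) _
  rw [fderiv_clm_apply hd (differentiableAt_const _), fderiv_clm_apply hd (differentiableAt_const _)]
  simp only [fderiv_fun_const, Pi.zero_apply, ContinuousLinearMap.comp_zero, zero_add,
    ContinuousLinearMap.flip_apply]
  exact (hω.contDiffAt.isSymmSndFDerivAt (by simp)).eq (1, 0) (0, 1)

end Slices

/-! ### Positivity of the denominator off the lattice lines -/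

/-- For `q₁ ∈ (−L/2, L/2]`, `q₁ ≠ 0`, the denominator `cosh(2πt/L) − cos(2πq₁/L)` is positive for all `t`.
[folklore] -/
theorem rowDen_pos_of_fst {L : ℝ} (hL : 0 < L) {q₁ : ℝ} (hq₁ : q₁ ∈ Ioc (-(L / 2)) (L / 2)) (h0 : q₁ ≠ 0)
    (t : ℝ) : 0 < Real.cosh (2 * π * t / L) - Real.cos (2 * π * q₁ / L) := by
  have hs : |2 * π * q₁ / L| ≤ π := abs_normFst_le_pi hL (q := (q₁, t)) (mk_mem_prod hq₁ (mem_univ _))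
  have hz : ((2 * π * q₁ / L, 2 * π * t / L) : ℝ × ℝ) ≠ 0 := by
    intro h
    have h1 : 2 * π * q₁ / L = 0 := congrArg Prod.fst h
    rw [div_eq_zero_iff, mul_eq_zero] at h1
    rcases h1 with (h1 | h1) | h1
    · exact absurd h1 (by positivity)
    · exact h0 h1
    · exact absurd h1 hL.ne'
  exact den_pos (z := ((2 * π * q₁ / L, 2 * π * t / L) : ℝ × ℝ)) hs hz

/-- For `t ≠ 0` the denominator `cosh(2πt/L) − cos(2πs/L)` is positive for all `s`. [folklore] -/
theorem rowDen_pos_of_snd {L : ℝ} (hL : 0 < L) {t : ℝ} (ht : t ≠ 0) (s : ℝ) :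
    0 < Real.cosh (2 * π * t / L) - Real.cos (2 * π * s / L) := by
  have h1 : 1 < Real.cosh (2 * π * t / L) := Real.one_lt_cosh.2 (by positivity)
  linarith [Real.cos_le_one (2 * π * s / L)]

/-- `∂_{q₂} Φ_L = (2π/L) K₁` where the denominator is positive. [folklore] -/
theorem hasDerivAt_rowLogKer_snd {L : ℝ} {s t : ℝ}
    (hD : 0 < Real.cosh (2 * π * t / L) - Real.cos (2 * π * s / L)) :
    HasDerivAt (fun t' => Real.log (Real.cosh (2 * π * t' / L) - Real.cos (2 * π * s / L)))
      (2 * π / L * (Real.sinh (2 * π * t / L) / (Real.cosh (2 * π * t / L) - Real.cos (2 * π * s / L)))) t := by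
  have hg : HasDerivAt (fun t' : ℝ => 2 * π * t' / L) (2 * π / L) t := by
    simpa using ((hasDerivAt_id' t).const_mul (2 * π)).div_const L
  refine ((hg.cosh.sub_const (Real.cos (2 * π * s / L))).log hD.ne').congr_deriv ?_
  ring

/-- `∂_{q₁} Φ_L = (2π/L) K₂` where the denominator is positive. [folklore] -/
theorem hasDerivAt_rowLogKer_fst {L : ℝ} {s t : ℝ}
    (hD : 0 < Real.cosh (2 * π * t / L) - Real.cos (2 * π * s / L)) :
    HasDerivAt (fun s' => Real.log (Real.cosh (2 * π * t / L) - Real.cos (2 * π * s' / L)))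
      (2 * π / L * (Real.sin (2 * π * s / L) / (Real.cosh (2 * π * t / L) - Real.cos (2 * π * s / L)))) s := by
  have hg : HasDerivAt (fun s' : ℝ => 2 * π * s' / L) (2 * π / L) s := by
    simpa using ((hasDerivAt_id' s).const_mul (2 * π)).div_const L
  refine ((hg.cos.const_sub (Real.cosh (2 * π * t / L))).log hD.ne').congr_deriv ?_
  ring

/-! ### Integration by parts in `q₂` on the line -/

section IBP

variable {L : ℝ} {ω : ℝ → ℝ → ℝ} {C a C' a' : ℝ}

/-- **IBP in `q₂`**: for `q₁ ∈ (−L/2, L/2]`, `q₁ ≠ 0`,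
`∫ Φ_L(q₁, t) (∂_yω)(x − q₁, y − t) dt = (2π/L) ∫ K₁(q₁, t) ω(x − q₁, y − t) dt`. [folklore] -/
theorem integral_rowLogKer_mul_dY (hL : 0 < L) (hω : ContDiff ℝ 1 fun p : ℝ × ℝ => ω p.1 p.2) (ha : 0 < a)
    (hb : ∀ x y, |ω x y| ≤ C * Real.exp (-a * y ^ 2)) (ha' : 0 < a')
    (hb' : ∀ p, ‖fderiv ℝ (fun p : ℝ × ℝ => ω p.1 p.2) p‖ ≤ C' * Real.exp (-a' * p.2 ^ 2)) {q₁ : ℝ}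
    (hq₁ : q₁ ∈ Ioc (-(L / 2)) (L / 2)) (h0 : q₁ ≠ 0) (x y : ℝ) :
    ∫ t, Real.log (Real.cosh (2 * π * t / L) - Real.cos (2 * π * q₁ / L)) * dY ω (x - q₁) (y - t) =
      2 * π / L * ∫ t, Real.sinh (2 * π * t / L) / (Real.cosh (2 * π * t / L) - Real.cos (2 * π * q₁ / L)) *
        ω (x - q₁) (y - t) := by
  set U : ℝ → ℝ := fun t => Real.log (Real.cosh (2 * π * t / L) - Real.cos (2 * π * q₁ / L))
  set U' : ℝ → ℝ := fun t =>
    2 * π / L * (Real.sinh (2 * π * t / L) / (Real.cosh (2 * π * t / L) - Real.cos (2 * π * q₁ / L)))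
  set V : ℝ → ℝ := fun t => ω (x - q₁) (y - t)
  set V' : ℝ → ℝ := fun t => -dY ω (x - q₁) (y - t)
  have hU : ∀ t, HasDerivAt U (U' t) t := fun t => hasDerivAt_rowLogKer_snd (rowDen_pos_of_fst hL hq₁ h0 t)
  have hV : ∀ t, HasDerivAt V (V' t) t := fun t =>
    HasDerivAt.comp_const_sub y t (hasDerivAt_slice_snd hω (x - q₁) (y - t))
  -- bounds along the line `{q₁} × ℝ`
  have hq0 : 0 < |q₁| := abs_pos.2 h0
  have hUb : ∀ t, |U t| ≤ 10 + L / π / |q₁| + 6 * π / L * |t| := fun t => by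
    have h := abs_rowLogKer_le hL (q := (q₁, t)) (mk_mem_prod hq₁ (mem_univ _))
    have hn : |q₁| ≤ ‖((q₁, t) : ℝ × ℝ)‖ := by rw [Prod.norm_def]; exact le_max_left _ _
    have : L / π / ‖((q₁, t) : ℝ × ℝ)‖ ≤ L / π / |q₁| := div_le_div_of_nonneg_left (by positivity) hq0 hn
    simp only at h; linarith
  have hU'b : ∀ t, |U' t| ≤ 2 * π / L * (2 + 10 * L / π / |q₁|) := fun t => by
    have h := abs_rowKerU_le hL (q := (q₁, t)) (mk_mem_prod hq₁ (mem_univ _))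
    have hn : |q₁| ≤ ‖((q₁, t) : ℝ × ℝ)‖ := by rw [Prod.norm_def]; exact le_max_left _ _
    have : 10 * L / π / ‖((q₁, t) : ℝ × ℝ)‖ ≤ 10 * L / π / |q₁| := div_le_div_of_nonneg_left (by positivity) hq0 hn
    simp only [U', abs_mul, abs_of_pos (by positivity : (0:ℝ) < 2 * π / L)] at h ⊢
    exact mul_le_mul_of_nonneg_left (by linarith) (by positivity)
  have hVb : ∀ t, |V t| ≤ C * Real.exp (-a * (y - t) ^ 2) := fun t => hb _ _
  have hV'b : ∀ t, |V' t| ≤ C' * Real.exp (-a' * (y - t) ^ 2) := fun t => by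
    simp only [V', abs_neg]; exact abs_dY_le hω hb' _ _
  have hC : 0 ≤ C := by have := (abs_nonneg _).trans (hb 0 0); simpa using this
  have hC' : 0 ≤ C' := by have := (norm_nonneg _).trans (hb' 0); simpa using this
  -- measurability
  have mU : AEStronglyMeasurable U := by
    have : Measurable U := by fun_prop
    exact this.aestronglyMeasurable
  have mU' : AEStronglyMeasurable U' := by
    have : Measurable U' := by fun_prop
    exact this.aestronglyMeasurable
  have mV : AEStronglyMeasurable V :=
    (hω.continuous.comp (continuous_const.prodMk (continuous_const.sub continuous_id))).aestronglyMeasurable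
  have mV' : AEStronglyMeasurable V' :=
    ((continuous_dY hω).comp (continuous_const.prodMk (continuous_const.sub continuous_id))).neg.aestronglyMeasurable
  -- integrability of the three products
  have key : ∀ {W : ℝ → ℝ} {K b : ℝ}, AEStronglyMeasurable W → 0 < b → (∀ t, |W t| ≤ K * Real.exp (-b * (y - t) ^ 2)) →
      Integrable (U * W) ∧ Integrable (U' * W) := by
    intro W K b mW hb0 hW
    have hK : 0 ≤ K := by
      have := (abs_nonneg _).trans (hW y); simpa using this
    constructor
    · have hi := (integrable_affine_mul_gauss_shift hb0 (10 + L / π / |q₁| + 6 * π / L * |y|) (6 * π / L) y).const_mul K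
      refine hi.mono' (mU.mul mW) (Eventually.of_forall fun t => ?_)
      rw [Pi.mul_apply, norm_mul, Real.norm_eq_abs, Real.norm_eq_abs]
      have ht : |t| ≤ |y| + |y - t| := by
        have := abs_sub_abs_le_abs_sub t y; rw [abs_sub_comm] at this; linarith
      have h1 := hUb t
      have he : 0 < Real.exp (-b * (y - t) ^ 2) := Real.exp_pos _
      calc |U t| * |W t| ≤ (10 + L / π / |q₁| + 6 * π / L * |t|) * (K * Real.exp (-b * (y - t) ^ 2)) :=
            mul_le_mul h1 (hW t) (abs_nonneg _) (by positivity)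
        _ ≤ (10 + L / π / |q₁| + 6 * π / L * (|y| + |y - t|)) * (K * Real.exp (-b * (y - t) ^ 2)) := by
            apply mul_le_mul_of_nonneg_right _ (by positivity)
            nlinarith [mul_le_mul_of_nonneg_left ht (by positivity : (0:ℝ) ≤ 6 * π / L)]
        _ = K * ((10 + L / π / |q₁| + 6 * π / L * |y| + 6 * π / L * |y - t|) * Real.exp (-b * (y - t) ^ 2)) := by
            ring
    · have hi := (integrable_affine_mul_gauss_shift hb0 (2 * π / L * (2 + 10 * L / π / |q₁|)) 0 y).const_mul K
      refine hi.mono' (mU'.mul mW) (Eventually.of_forall fun t => ?_)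
      rw [Pi.mul_apply, norm_mul, Real.norm_eq_abs, Real.norm_eq_abs]
      calc |U' t| * |W t| ≤ (2 * π / L * (2 + 10 * L / π / |q₁|)) * (K * Real.exp (-b * (y - t) ^ 2)) :=
            mul_le_mul (hU'b t) (hW t) (abs_nonneg _) (by positivity)
        _ = K * ((2 * π / L * (2 + 10 * L / π / |q₁|) + 0 * |y - t|) * Real.exp (-b * (y - t) ^ 2)) := by ring
  have iUV' : Integrable (U * V') := (key mV' ha' hV'b).1
  have iU'V : Integrable (U' * V) := (key mV ha hVb).2
  have iUV : Integrable (U * V) := (key mV ha hVb).1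
  have h := integral_mul_deriv_eq_deriv_mul_of_integrable (fun t _ => hU t) (fun t _ => hV t) iUV' iU'V iUV
  -- `∫ U (−dYω) = −∫ U' V`
  have h2 : ∫ t, U t * V' t = -∫ t, U t * dY ω (x - q₁) (y - t) := by
    rw [← integral_neg]; refine integral_congr_ae (Eventually.of_forall fun t => ?_); simp [V']
  rw [h2, neg_inj] at h
  rw [h, ← integral_const_mul]
  refine integral_congr_ae (Eventually.of_forall fun t => ?_)
  simp only [U', V]; ring

end IBP

end RowBiotSavart

open RowBiotSavart in
/-- **Integration by parts along the lines of the strip** (registered on stmt-AnomalousDissipation-3009 as the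
helper stub `stub_rowVorticityConstruction_streamIBPLine` of `stub_rowVorticityConstruction`): for `L > 0`,
`ω ∈ C¹` with Gaussian bounds on `ω` and `Dω`, and `q₁ ∈ (−L/2, L/2]`, `q₁ ≠ 0`,
`∫ Φ_L(q₁, t) (∂_yω)(x − q₁, y − t) dt = (2π/L) ∫ K₁(q₁, t) ω(x − q₁, y − t) dt` — the line-by-line identity
behind `∂_yΨ = (2π/L) U` (`RowBiotSavart.integral_rowLogKer_mul_dY`). [folklore] -/
theorem stub_rowVorticityConstruction_streamIBPLine :
    ∀ (L : ℝ) (ω : ℝ → ℝ → ℝ) (C a C' a' : ℝ), 0 < L → ContDiff ℝ 1 (fun p : ℝ × ℝ => ω p.1 p.2) → 0 < a →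
      (∀ x y, |ω x y| ≤ C * Real.exp (-a * y ^ 2)) → 0 < a' →
      (∀ p : ℝ × ℝ, ‖fderiv ℝ (fun p : ℝ × ℝ => ω p.1 p.2) p‖ ≤ C' * Real.exp (-a' * p.2 ^ 2)) →
      ∀ q₁ ∈ Set.Ioc (-(L / 2)) (L / 2), q₁ ≠ 0 → ∀ x y : ℝ,
        ∫ t, Real.log (Real.cosh (2 * Real.pi * t / L) - Real.cos (2 * Real.pi * q₁ / L)) * dY ω (x - q₁) (y - t) =
          2 * Real.pi / L * ∫ t, Real.sinh (2 * Real.pi * t / L) /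
            (Real.cosh (2 * Real.pi * t / L) - Real.cos (2 * Real.pi * q₁ / L)) * ω (x - q₁) (y - t) :=
  fun _ _ _ _ _ _ hL hω ha hb ha' hb' _ hq₁ h0 x y => integral_rowLogKer_mul_dY hL hω ha hb ha' hb' hq₁ h0 x y

end Summit.AnomalousDissipation.AnomalousDissipation.Theorems.MarginalStabilityChainStretchedVortexRows

end
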